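import Summits.AtomisticToContinuum.BoseEinsteinCondensation.Theorems.BECCutLineWeakDisorderTwoReplicaTransienceBoundSliceMoment
import Summits.AtomisticToContinuum.BoseEinsteinCondensation.Theorems.BECCutLineWeakDisorderTwoReplicaTransienceBoundSlicedDomination
import Summits.AtomisticToContinuum.BoseEinsteinCondensation.Theorems.BECCutLineWeakDisorderTwoReplicaTransienceBoundSlicedPenalty
import Summits.AtomisticToContinuum.BoseEinsteinCondensation.Theorems.BECCutLineWeakDisorderTwoReplicaTransienceBoundSurvivalFloor
import Summits.AtomisticToContinuum.BoseEinsteinCondensation.Theorems.BECCutLineWeakDisorderTwoReplicaTransienceBoundRecursion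
import Summits.AtomisticToContinuum.BoseEinsteinCondensation.Theorems.BECCutLineWeakDisorderTwoReplicaTransienceBoundSliceBound
import Literature.MathematicalPhysics.QuantumManyBody.BoseGasThermodynamicLimitRuelle
import HarnessLib

/-!
# Crux `TwoReplicaTransienceBound` (stmt-AtomisticToContinuum-9687), line `SketchIdeator1` v7:
# the crux up to the MEAN-FREE time for every admissible pair potential
# (stubs `stub_slicedInsertionStep`, `stub_meanFreeWindow`)

Support file (`--supports stmt-AtomisticToContinuum-9687`, lead c4). **The two-replica overlap of the Feynman–Kac
heat-flow witnesses is bounded by the absolute constant `20`, uniformly in the particle number, for EVERY admissible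
pair potential (hard cores included), for all polymer lengths up to the kinetic (mean-free) time:**

`∀ v admissible, ∃ κ > 0, ∃ ρ₁ > 0, ∀ ρ ∈ (0, ρ₁), ∀ᶠ n, ∀ T ∈ [0, κ/ρ]: ∫ L³ m_T(Y)²/s_T(Y)² dY ≤ 20`

(`Ψ_T = fkWitness v L T 1`, `L = sideLength ρ (n+1)`; explicitly `κ = q₀²/(1024 (K₁+1))`, `ρ₁ = q₀²/(512 (K₁+1))`,
`q₀ = 1 - 6e⁻⁵`, `K₁ = K₁(R) = 1 + 128 R⁴ + 2·110592·3·18` the unit-slice cubic sausage moment, `R` the range of `v`).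
This strictly contains lead c3's short window `∀ T₀ ∃ ρ₁(T₀)` (`…ShortTime.lean`; take `ρ₁' = min ρ₁ (κ/T₀)`), which
covered `T ≲ ρ^{-2/3}`, and brings the hard-core case to parity with c3's bounded-`v` chemical-potential window
(`…ShortTimeBounded.lean`). The scale-covariant form (slices of length `R²`: window `{ρR³ ≤ 10⁻⁹, ρRT ≤ 10⁻⁹}`) is
`stub_kineticWindow` (…KineticWindow.lean). Ingredients:

* the SLICED insertion step, abstract in the slice length `h` and the per-slice moment bound `K`
  (`MeanFreeWindow.sliced_insertion_of_sliceBound`): `Θ·N_{n+1} ≤ N_{n+2} + (n+1)·|Λ_L|·(M·K)·N_n` for `2T ≤ M h` —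
  c3's generic insertion inequality `Insertion.insertion_generic` with the time-sliced sausage penalty: domination
  `stub_slicedDomination` (…SlicedDomination.lean), measurability and `y`-integral `stub_slicedPenaltyMeasurable` /
  `stub_slicedPenaltyIntegral` (…SlicedPenalty.lean); with unit slices and the per-slice moment `stub_sliceMoment`
  (…SliceMoment.lean: Markov increments `incRunSup`, Doob's `L⁴` bound) this is `stub_slicedInsertionStep`, whose error
  is LINEAR in `T` (Spitzer) instead of c3's `T^{3/2}` (one ball for the whole time interval);
* c3's recursion `stub_recursion`, survival floor `stub_survivalFloor` (`Θ ≥ q₀ (L/2)³` for `2T ≤ L²/960`) and slice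
  reduction `ShortTime.lintegral_ratio_le` (crux integral `≤ L³ N_n / N_{n+1}`), with `M = ⌊2T⌋₊ + 1 ≤ 2T + 1` and the
  smallness `256 ρ (2T+1) K₁ ≤ q₀²`.

Beyond the kinetic time insertion costs `e^{-μT}` (`μ ≍ ρ a`) and the slice bound is no longer affordable: that is the
open stub `stub_beyondMeanFreeTime` (⟺ crux).
-/

noncomputable section

namespace Summit.AtomisticToContinuum.BoseEinsteinCondensation.Cruxes.TwoReplicaTransienceBound.TracerDecoupling

open MeasureTheory Filter Set
open scoped ENNReal NNReal Topology BigOperators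
open Literature.MathematicalPhysics.QuantumManyBody.BoseGas
open Literature.Probability.Process (brownian incRunSup preWienerMeasure)


namespace MeanFreeWindow

open Summit.AtomisticToContinuum.BoseEinsteinCondensation.Cruxes.TwoReplicaTransienceBound.Insertion

/-- **The sliced error functional at a tagged point is at most `M · K`** whenever every slice's cubic sausage moment is
`≤ K`: `∫ dy ∫ dW(ω) ∫ dW(ω₀) P_M(x,ω₀,y,ω) ≤ Σ_{k<M} E[(2 r_k)³] ≤ M · K` (`stub_slicedPenaltyIntegral`, slice by slice). -/
theorem lintegral_slicedPenalty_le_mul {R : ℝ} (hR : 0 ≤ R) (h : ℝ≥0) (M : ℕ) {K : ℝ≥0∞}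
    (hK : ∀ k : ℕ, ∫⁻ ω₀, ∫⁻ ω, ENNReal.ofReal ((2 * (R + Real.sqrt 2 *
        ((∑ c, incRunSup ((k : ℝ≥0) * h) h (ω₀ c)) + ∑ c, incRunSup ((k : ℝ≥0) * h) h (ω c)))) ^ 3)
        ∂wienerLine ∂wienerLine ≤ K) (x : Space) :
    ∫⁻ y, ∫⁻ ω, ∫⁻ ω₀,
        (∑ k ∈ Finset.range M,
          (Metric.closedBall
            (x + WithLp.toLp 2 (fun c : Fin 3 => Real.sqrt 2 * brownian ((k : ℝ≥0) * h) (ω₀ c)) -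
              WithLp.toLp 2 (fun c : Fin 3 => Real.sqrt 2 * brownian ((k : ℝ≥0) * h) (ω c)))
            (R + Real.sqrt 2 * ((∑ c, incRunSup ((k : ℝ≥0) * h) h (ω₀ c)) +
              ∑ c, incRunSup ((k : ℝ≥0) * h) h (ω c)))).indicator (fun _ => (1 : ℝ≥0∞)) y)
        ∂wienerLine ∂wienerLine ≤ (M : ℝ≥0∞) * K := by
  refine (stub_slicedPenaltyIntegral R hR h M x).trans ?_
  calc ∑ k ∈ Finset.range M, ∫⁻ ω₀, ∫⁻ ω, ENNReal.ofReal ((2 * (R + Real.sqrt 2 *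
          ((∑ c, incRunSup ((k : ℝ≥0) * h) h (ω₀ c)) + ∑ c, incRunSup ((k : ℝ≥0) * h) h (ω c)))) ^ 3)
          ∂wienerLine ∂wienerLine
      ≤ ∑ _k ∈ Finset.range M, K := Finset.sum_le_sum fun k _ => hK k
    _ = (M : ℝ≥0∞) * K := by rw [Finset.sum_const, Finset.card_range, nsmul_eq_mul]

/-- **The sliced insertion step, abstract in the slice length `h` and the per-slice moment bound `K`**: for every
finite-range `v` (hard cores allowed), at a fixed box and polymer length `T` with `2T ≤ M h`,
`Θ·N_{n+1} ≤ N_{n+2} + (n+1)·|Λ_L|·(M·K)·N_n` — c3's `insertion_generic` with the sliced penalty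
(`stub_slicedDomination`, `stub_slicedPenaltyMeasurable`, `lintegral_slicedPenalty_le_mul`), `|Λ_L| = L³`,
`‖e^{-TH}1‖₂² = ∫Z_{2T}` (`fkNormSq_one_eq_lintegral_fkPartition`). -/
theorem sliced_insertion_of_sliceBound {n : ℕ} {v : ℝ → ℝ≥0∞} (hv : Measurable v) {R : ℝ} (hR : 0 ≤ R)
    (hvR : ∀ r, R < r → v r = 0) {L T : ℝ} (hL : 0 < L) (hT : 0 ≤ T) {h : ℝ≥0} (hh : 0 < h) {M : ℕ} (hM : 1 ≤ M)
    (h2TM : 2 * T ≤ (M : ℝ) * h) {K : ℝ≥0∞}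
    (hK : ∀ k : ℕ, ∫⁻ ω₀, ∫⁻ ω, ENNReal.ofReal ((2 * (R + Real.sqrt 2 *
        ((∑ c, incRunSup ((k : ℝ≥0) * h) h (ω₀ c)) + ∑ c, incRunSup ((k : ℝ≥0) * h) h (ω c)))) ^ 3)
        ∂wienerLine ∂wienerLine ≤ K) :
    @fkNormSq 1 (fun _ => 0) L T (fun _ => (1 : ENNReal)) * @fkNormSq (n + 1) v L T (fun _ => (1 : ENNReal)) ≤
      @fkNormSq (n + 2) v L T (fun _ => (1 : ENNReal)) +
        ((n : ENNReal) + 1) * ENNReal.ofReal (L ^ 3) * ((M : ENNReal) * K) *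
          @fkNormSq n v L T (fun _ => (1 : ENNReal)) := by
  have h2T : 0 ≤ 2 * T := by linarith
  -- the generic inequality at polymer length `2T` with the sliced penalty
  have hgen := insertion_generic (n := n) hv L h2T
    (fun x ω₀ y ω => ∑ k ∈ Finset.range M,
      (Metric.closedBall
        (x + WithLp.toLp 2 (fun c : Fin 3 => Real.sqrt 2 * brownian ((k : ℝ≥0) * h) (ω₀ c)) -
          WithLp.toLp 2 (fun c : Fin 3 => Real.sqrt 2 * brownian ((k : ℝ≥0) * h) (ω c)))
        (R + Real.sqrt 2 * ((∑ c, incRunSup ((k : ℝ≥0) * h) h (ω₀ c)) +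
          ∑ c, incRunSup ((k : ℝ≥0) * h) h (ω c)))).indicator (fun _ => (1 : ℝ≥0∞)) y)
    (stub_slicedPenaltyMeasurable R h M)
    (fun x ω₀ Y ωb => stub_slicedDomination (n + 1) v R hvR h hh M hM (2 * T) h2TM x Y ω₀ ωb)
  -- the norms as `2T`-long partition integrals
  have hΘ : @fkNormSq 1 (fun _ => 0) L T (fun _ => (1 : ENNReal)) =
      ∫⁻ x, fkPartition (N := 1) (fun _ => 0) L (2 * T) (fun _ => x) := by
    rw [fkNormSq_one_eq_lintegral_fkPartition measurable_const L hT, FreeGas.lintegral_config_one]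
  rw [hΘ, fkNormSq_one_eq_lintegral_fkPartition hv L hT, fkNormSq_one_eq_lintegral_fkPartition hv L hT,
    fkNormSq_one_eq_lintegral_fkPartition hv L hT]
  refine hgen.trans (add_le_add le_rfl ?_)
  -- the error coefficient: `∫_{x ∈ Λ} G ≤ |Λ| · (M · K)`
  rw [mul_assoc ((n : ℝ≥0∞) + 1) (ENNReal.ofReal (L ^ 3))]
  refine mul_le_mul' (mul_le_mul' le_rfl ?_) le_rfl
  calc ∫⁻ x in box L, ∫⁻ y, ∫⁻ ω, ∫⁻ ω₀, (∑ k ∈ Finset.range M,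
          (Metric.closedBall
            (x + WithLp.toLp 2 (fun c : Fin 3 => Real.sqrt 2 * brownian ((k : ℝ≥0) * h) (ω₀ c)) -
              WithLp.toLp 2 (fun c : Fin 3 => Real.sqrt 2 * brownian ((k : ℝ≥0) * h) (ω c)))
            (R + Real.sqrt 2 * ((∑ c, incRunSup ((k : ℝ≥0) * h) h (ω₀ c)) +
              ∑ c, incRunSup ((k : ℝ≥0) * h) h (ω c)))).indicator (fun _ => (1 : ℝ≥0∞)) y)
          ∂wienerLine ∂wienerLine
      ≤ ∫⁻ _x in box L, (M : ℝ≥0∞) * K := lintegral_mono fun x => lintegral_slicedPenalty_le_mul hR h M hK x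
    _ = _ := by
        rw [setLIntegral_const, volume_box, ← ENNReal.ofReal_pow hL.le, mul_comm]

end MeanFreeWindow

open MeanFreeWindow
open Summit.AtomisticToContinuum.BoseEinsteinCondensation.Cruxes.TwoReplicaTransienceBound.Insertion
open Summit.AtomisticToContinuum.BoseEinsteinCondensation.Theorems.CutLineWitness
open Summit.AtomisticToContinuum.BoseEinsteinCondensation.Cruxes.TwoReplicaTransienceBound.ShortTime

/-- **Registered stub `stub_slicedInsertionStep`** (crux stmt-AtomisticToContinuum-9687, line `SketchIdeator1` v7): the
SLICED insertion step with UNIT slices, `Θ·N_{n+1} ≤ N_{n+2} + (n+1)·|Λ_L|·(M·K₁(R))·N_n` for every finite-range pair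
potential (hard cores allowed), at a fixed box and polymer length `T` with `2T ≤ M` — `MeanFreeWindow.sliced_insertion_of_sliceBound`
at `h = 1` with the per-slice moment `stub_sliceMoment` (`K₁(R) = 1 + 128R⁴ + 2·110592·3·18`). -/
theorem stub_slicedInsertionStep :
    ∀ (n : ℕ) (v : ℝ → ENNReal), Measurable v → ∀ (R : ℝ), 0 ≤ R → (∀ r, R < r → v r = 0) →
      ∀ (L T : ℝ), 0 < L → 0 ≤ T → ∀ (M : ℕ), 1 ≤ M → 2 * T ≤ (M : ℝ) →
        @fkNormSq 1 (fun _ => 0) L T (fun _ => (1 : ENNReal)) *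
            @fkNormSq (n + 1) v L T (fun _ => (1 : ENNReal)) ≤
          @fkNormSq (n + 2) v L T (fun _ => (1 : ENNReal)) +
            ((n : ENNReal) + 1) * ENNReal.ofReal (L ^ 3) *
              ((M : ENNReal) * (ENNReal.ofReal (1 + 128 * R ^ 4) + 2 * (110592 * (3 * ENNReal.ofReal 18)))) *
              @fkNormSq n v L T (fun _ => (1 : ENNReal)) := by
  intro n v hv R hR hvR L T hL hT M hM h2TM
  have h2TM' : 2 * T ≤ (M : ℝ) * ((1 : ℝ≥0) : ℝ) := by rw [NNReal.coe_one, mul_one]; exact h2TM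
  have hK : ∀ k : ℕ, ∫⁻ ω₀, ∫⁻ ω, ENNReal.ofReal ((2 * (R + Real.sqrt 2 *
      ((∑ c, incRunSup ((k : ℝ≥0) * 1) 1 (ω₀ c)) + ∑ c, incRunSup ((k : ℝ≥0) * 1) 1 (ω c)))) ^ 3)
      ∂wienerLine ∂wienerLine ≤ ENNReal.ofReal (1 + 128 * R ^ 4) + 2 * (110592 * (3 * ENNReal.ofReal 18)) := by
    intro k
    have h := stub_sliceMoment R ((k : ℝ≥0) * 1) 1
    simpa using h
  exact sliced_insertion_of_sliceBound hv hR hvR hL hT one_pos hM h2TM' hK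

/-- **Registered stub `stub_meanFreeWindow`** (crux stmt-AtomisticToContinuum-9687, line `SketchIdeator1` v7): **the crux up to
the MEAN-FREE (kinetic) time, uniformly in `n`, for every admissible `v` (hard cores included), with the absolute constant `20`.**
Given `v` (range `R₀`): `R = max R₀ 0`, `K₁ = 1 + 128R⁴ + 2·110592·3·18`, `q₀ = 1 − 6e⁻⁵`, `κ = q₀²/(1024(K₁+1))`,
`ρ₁ = q₀²/(512(K₁+1))`; for `ρ < ρ₁`, eventually `L² ≥ 1920 κ/ρ`; for `T ∈ [0, κ/ρ]` take `M = ⌊2T⌋₊ + 1 ≤ 2T + 1` unit slices: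
the recursion `stub_recursion` (steps `stub_slicedInsertionStep`, base `N_1 = Θ`, `N_0 ≤ 1`, smallness `256 ρ (2T+1) K₁ ≤ q₀²` and
the survival floor `stub_survivalFloor`) gives `Θ N_n ≤ 2N_{n+1}`, and the slice reduction `lintegral_ratio_le` gives
`∫L³m²/s² ≤ 2L³/Θ ≤ 16/q₀ ≤ 20`. Contains c3's `stub_shortTime` (take `ρ₁' = min ρ₁ (κ/T₀)`). -/
theorem stub_meanFreeWindow :
    ∀ (v : ℝ → ENNReal), IsRepulsiveFiniteRange v → ∃ κ : ℝ, 0 < κ ∧ ∃ ρ₁ : ℝ, 0 < ρ₁ ∧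
      ∀ ρ : ℝ, 0 < ρ → ρ < ρ₁ → ∀ᶠ n : ℕ in Filter.atTop, ∀ T : ℝ, 0 ≤ T → T ≤ κ / ρ →
        ∫⁻ Y : Config n, ENNReal.ofReal (sideLength ρ (n + 1) ^ 3) *
            (∫⁻ x, (‖@fkWitness (n + 1) v (sideLength ρ (n + 1)) T (fun _ => (1 : ENNReal))
              (Matrix.vecCons x Y)‖₊ : ENNReal) ^ 2) ^ 2 /
            (∫⁻ x, (‖@fkWitness (n + 1) v (sideLength ρ (n + 1)) T (fun _ => (1 : ENNReal))
              (Matrix.vecCons x Y)‖₊ : ENNReal)) ^ 2 ≤ ENNReal.ofReal 20 := by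
  intro v hv
  obtain ⟨hvm, R₀, hR₀⟩ := hv
  -- the range, made nonnegative
  set R : ℝ := max R₀ 0 with hRdef
  have hR : 0 ≤ R := le_max_right _ _
  have hvR : ∀ r, R < r → v r = 0 := fun r hr => hR₀ r (lt_of_le_of_lt (le_max_left _ _) hr)
  -- the unit-slice sausage constant
  set K : ℝ≥0∞ := ENNReal.ofReal (1 + 128 * R ^ 4) + 2 * (110592 * (3 * ENNReal.ofReal 18)) with hKdef
  have hKtop : K ≠ ⊤ := ENNReal.add_ne_top.2 ⟨ENNReal.ofReal_ne_top, ENNReal.mul_ne_top (by norm_num)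
    (ENNReal.mul_ne_top (by norm_num) (ENNReal.mul_ne_top (by norm_num) ENNReal.ofReal_ne_top))⟩
  set q₀ : ℝ := 1 - 6 * Real.exp (-5) with hq₀def
  have hq₀ : 0 < q₀ := FreeGas.q0_pos
  set Kr : ℝ := K.toReal with hKrdef
  have hKr : 0 ≤ Kr := ENNReal.toReal_nonneg
  have hKeq : K = ENNReal.ofReal Kr := (ENNReal.ofReal_toReal hKtop).symm
  refine ⟨q₀ ^ 2 / (1024 * (Kr + 1)), by positivity, q₀ ^ 2 / (512 * (Kr + 1)), by positivity,
    fun ρ hρ hρ₁ => ?_⟩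
  set κ : ℝ := q₀ ^ 2 / (1024 * (Kr + 1)) with hκdef
  have hκ : 0 < κ := by positivity
  -- eventually in `n`: the box is large, `L ≥ L₀ = √(1920 κ/ρ)`
  set L₀ : ℝ := Real.sqrt (1920 * (κ / ρ)) with hL₀def
  have hL₀ : 0 ≤ L₀ := Real.sqrt_nonneg _
  have hev : ∀ᶠ n : ℕ in Filter.atTop, L₀ ≤ sideLength ρ (n + 1) :=
    ((tendsto_sideLength_atTop hρ).comp (tendsto_add_atTop_nat 1)).eventually_ge_atTop L₀
  filter_upwards [hev] with n hn T hT hTκ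
  set L : ℝ := sideLength ρ (n + 1) with hLdef
  have hL : 0 < L := Real.rpow_pos_of_pos (div_pos (by exact_mod_cast Nat.succ_pos n) hρ) _
  have hL3 : L ^ 3 = ((n + 1 : ℕ) : ℝ) / ρ := sideLength_pow_three hρ (n + 1)
  -- the window condition `2T ≤ L²/960`
  have h2T : 2 * T ≤ L ^ 2 / 960 := by
    have h1 : L₀ ^ 2 ≤ L ^ 2 := pow_le_pow_left₀ hL₀ hn 2
    rw [hL₀def, Real.sq_sqrt (by positivity)] at h1
    linarith
  -- the number of unit slices
  set M : ℕ := ⌊2 * T⌋₊ + 1 with hMdef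
  have hM : 1 ≤ M := Nat.le_add_left 1 _
  have h2TM : 2 * T ≤ (M : ℝ) := by
    rw [hMdef, Nat.cast_add_one]
    exact (Nat.lt_floor_add_one (2 * T)).le
  have hMle : (M : ℝ) ≤ 2 * T + 1 := by
    rw [hMdef, Nat.cast_add_one]
    have h0 : (0 : ℝ) ≤ 2 * T := by linarith
    have h1 : ((⌊2 * T⌋₊ : ℕ) : ℝ) ≤ 2 * T := Nat.floor_le h0
    linarith
  have hρT : ρ * T ≤ κ := by
    rw [le_div_iff₀ hρ] at hTκ; linarith
  /- ### the partition norms at this box and time -/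
  set N : ℕ → ℝ≥0∞ := fun k => fkNormSq (N := k) v L T (fun _ => (1 : ℝ≥0∞)) with hNdef
  set Θ : ℝ≥0∞ := fkNormSq (N := 1) (fun _ => 0) L T (fun _ => (1 : ℝ≥0∞)) with hΘdef
  have hNtop : ∀ k, N k ≠ ⊤ := fun k =>
    Summit.AtomisticToContinuum.BoseEinsteinCondensation.Theorems.TwoReplicaTransienceBound.Negative.fkNormSq_one_ne_top
      (N := k) v L hT
  have hΘtop : Θ ≠ ⊤ :=
    Summit.AtomisticToContinuum.BoseEinsteinCondensation.Theorems.TwoReplicaTransienceBound.Negative.fkNormSq_one_ne_top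
      (N := 1) (fun _ => 0) L hT
  -- survival floor
  set θ₀ : ℝ≥0∞ := ENNReal.ofReal (q₀ * (L / 2) ^ 3) with hθ₀def
  have hθ₀Θ : θ₀ ≤ Θ := stub_survivalFloor L T hL hT h2T
  have hθ₀pos : θ₀ ≠ 0 := by
    rw [hθ₀def]; exact (ENNReal.ofReal_pos.2 (by positivity)).ne'
  have hθ₀top : θ₀ ≠ ⊤ := ENNReal.ofReal_ne_top
  -- the error coefficient `A = n · |Λ| · (M · K)`
  set A : ℝ≥0∞ := (n : ℝ≥0∞) * (ENNReal.ofReal (L ^ 3) * ((M : ℝ≥0∞) * K)) with hAdef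
  -- base of the recursion: `Θ N₀ ≤ N₁ = Θ`
  have hbase : Θ * N 0 ≤ N 1 := by
    calc Θ * N 0 ≤ Θ * 1 := mul_le_mul' le_rfl (fkNormSq_zero_particle_le v L T)
      _ = N 1 := by rw [mul_one, hNdef]; exact (fkNormSq_one_particle v L T).symm
  -- steps of the recursion (the sliced insertion step)
  have hsteps : ∀ k, k + 2 ≤ n + 1 → Θ * N (k + 1) ≤ N (k + 2) + A * N k := by
    intro k hk
    have hins := stub_slicedInsertionStep k v hvm R hR hvR L T hL hT M hM h2TM
    refine hins.trans (add_le_add le_rfl (mul_le_mul' ?_ le_rfl))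
    have hk' : ((k : ℝ≥0∞) + 1) ≤ (n : ℝ≥0∞) := by exact_mod_cast (by omega : k + 1 ≤ n)
    calc ((k : ℝ≥0∞) + 1) * ENNReal.ofReal (L ^ 3) * ((M : ℝ≥0∞) * K)
        ≤ (n : ℝ≥0∞) * ENNReal.ofReal (L ^ 3) * ((M : ℝ≥0∞) * K) := mul_le_mul' (mul_le_mul' hk' le_rfl) le_rfl
      _ = A := by rw [hAdef, mul_assoc]
  -- smallness `4A ≤ Θ²` from `ρ < q₀²/(512 (K+1))` and `ρ T ≤ q₀²/(1024 (K+1))`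
  have hsmall : 4 * A ≤ Θ ^ 2 := by
    have hreal : 4 * ((n : ℝ) * (L ^ 3 * ((M : ℝ) * Kr))) ≤ (q₀ * (L / 2) ^ 3) ^ 2 := by
      have hn0 : (0 : ℝ) ≤ n := Nat.cast_nonneg n
      have hM0 : (0 : ℝ) ≤ M := Nat.cast_nonneg M
      -- `256 ρ (2T+1) Kr ≤ q₀²`
      have h1a : ρ * (512 * (Kr + 1)) ≤ q₀ ^ 2 := by
        have := hρ₁.le
        rwa [le_div_iff₀ (by positivity)] at this
      have h1b : ρ * T * (1024 * (Kr + 1)) ≤ q₀ ^ 2 := by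
        have := hρT
        rwa [hκdef, le_div_iff₀ (by positivity)] at this
      have h2 : 256 * (M : ℝ) * Kr * ρ ≤ q₀ ^ 2 := by
        nlinarith [mul_nonneg hρ.le hKr, mul_nonneg (mul_nonneg hρ.le hT) hKr, hMle]
      have h3 : 256 * (n : ℝ) * ((M : ℝ) * Kr) * ρ ≤ q₀ ^ 2 * ((n : ℝ) + 1) := by
        nlinarith [mul_nonneg (mul_nonneg hM0 hKr) hρ.le, sq_nonneg q₀]
      have h4 : (q₀ * (L / 2) ^ 3) ^ 2 = q₀ ^ 2 * (L ^ 3) ^ 2 / 64 := by ring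
      rw [h4, hL3, Nat.cast_succ]
      rw [le_div_iff₀ (by norm_num : (0 : ℝ) < 64)]
      have hρne : ρ ≠ 0 := hρ.ne'
      field_simp
      nlinarith [h3, hn0, hKr, hρ.le, hM0, mul_nonneg hM0 hKr]
    calc 4 * A = ENNReal.ofReal (4 * ((n : ℝ) * (L ^ 3 * ((M : ℝ) * Kr)))) := by
          rw [hAdef, hKeq, ENNReal.ofReal_mul (by norm_num), ENNReal.ofReal_mul (Nat.cast_nonneg n),
            ENNReal.ofReal_mul (by positivity), ENNReal.ofReal_mul (Nat.cast_nonneg M), ENNReal.ofReal_natCast,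
            ENNReal.ofReal_natCast, ENNReal.ofReal_ofNat]
      _ ≤ ENNReal.ofReal ((q₀ * (L / 2) ^ 3) ^ 2) := ENNReal.ofReal_le_ofReal hreal
      _ = θ₀ ^ 2 := by rw [hθ₀def, ENNReal.ofReal_pow (by positivity)]
      _ ≤ Θ ^ 2 := pow_le_pow_left' hθ₀Θ 2
  -- the recursion
  have hrec : Θ * N n ≤ 2 * N (n + 1) := stub_recursion N Θ A (n + 1) hΘtop hNtop hbase hsteps hsmall n le_rfl
  /- ### the crux integral: normalisation bookkeeping and the slice reduction -/
  set 𝒩 : ℝ≥0∞ := fkNormSq (N := n + 1) v L T (fun _ => (1 : ℝ≥0∞)) with h𝒩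
  set c : ℝ := (Real.sqrt 𝒩.toReal)⁻¹ with hc
  have hΨ : ∀ X, fkWitness (N := n + 1) v L T (fun _ => (1 : ℝ≥0∞)) X = c * (fkPartition v L T X).toReal :=
    fun X => fkWitness_one_eq v L T X
  by_cases hc0 : c = 0
  · have h0 : ∀ X, fkWitness (N := n + 1) v L T (fun _ => (1 : ℝ≥0∞)) X = 0 := fun X => by
      rw [hΨ X, hc0, zero_mul]
    simp [h0]
  have hsqrt : Real.sqrt 𝒩.toReal ≠ 0 := fun h => hc0 (by rw [hc, h, inv_zero])
  have htR : 0 < 𝒩.toReal := not_le.1 fun h => hsqrt (Real.sqrt_eq_zero'.2 h)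
  have h𝒩0 : 𝒩 ≠ 0 := fun h => htR.ne' (by rw [h, ENNReal.toReal_zero])
  have h𝒩top : 𝒩 ≠ ⊤ := fun h => htR.ne' (by rw [h, ENNReal.toReal_top])
  have hc𝒩 : ENNReal.ofReal (c ^ 2) * 𝒩 = 1 := by
    have hc2 : c ^ 2 = (𝒩.toReal)⁻¹ := by rw [hc, inv_pow, Real.sq_sqrt htR.le]
    rw [hc2, ENNReal.ofReal_inv_of_pos htR, ENNReal.ofReal_toReal h𝒩top, ENNReal.inv_mul_cancel h𝒩0 h𝒩top]
  have hnn : ∀ X : Config (n + 1), (‖(fkPartition v L T X).toReal‖₊ : ℝ≥0∞) = fkPartition v L T X :=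
    fun X => coe_nnnorm_toReal (fkPartition_ne_top v L T X)
  simp_rw [hΨ]
  rw [lintegral_ratio_const_mul L (fun X => (fkPartition v L T X).toReal) hc0]
  simp_rw [hnn]
  -- `I ≤ c² · L³ · N_n`, and `Θ · (c² L³ N_n) ≤ c² L³ · 2 N_{n+1} = 2 L³`
  set I : ℝ≥0∞ := ENNReal.ofReal (c ^ 2) * ∫⁻ Y : Config n, ENNReal.ofReal (L ^ 3) *
      (∫⁻ x, fkPartition v L T (Matrix.vecCons x Y) ^ 2) ^ 2 /
        (∫⁻ x, fkPartition v L T (Matrix.vecCons x Y)) ^ 2 with hI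
  have hI1 : I ≤ ENNReal.ofReal (c ^ 2) * (ENNReal.ofReal (L ^ 3) * N n) :=
    mul_le_mul' le_rfl (lintegral_ratio_le hvm L T)
  have hI2 : Θ * I ≤ 2 * ENNReal.ofReal (L ^ 3) := by
    calc Θ * I ≤ Θ * (ENNReal.ofReal (c ^ 2) * (ENNReal.ofReal (L ^ 3) * N n)) := mul_le_mul' le_rfl hI1
      _ = ENNReal.ofReal (c ^ 2) * ENNReal.ofReal (L ^ 3) * (Θ * N n) := by ring
      _ ≤ ENNReal.ofReal (c ^ 2) * ENNReal.ofReal (L ^ 3) * (2 * N (n + 1)) := mul_le_mul' le_rfl hrec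
      _ = 2 * ENNReal.ofReal (L ^ 3) * (ENNReal.ofReal (c ^ 2) * 𝒩) := by rw [hNdef]; ring
      _ = 2 * ENNReal.ofReal (L ^ 3) := by rw [hc𝒩, mul_one]
  -- divide by the survival floor
  have hI3 : I ≤ 2 * ENNReal.ofReal (L ^ 3) / θ₀ := by
    rw [ENNReal.le_div_iff_mul_le (Or.inl hθ₀pos) (Or.inl hθ₀top)]
    calc I * θ₀ = θ₀ * I := mul_comm _ _
      _ ≤ Θ * I := mul_le_mul' hθ₀Θ le_rfl
      _ ≤ 2 * ENNReal.ofReal (L ^ 3) := hI2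
  refine hI3.trans ?_
  -- `2 L³ / (q₀ (L/2)³) = 16/q₀ ≤ 20`
  have hL3pos : 0 < L ^ 3 := by positivity
  rw [hθ₀def, ← ENNReal.ofReal_ofNat 2, ← ENNReal.ofReal_mul (by norm_num),
    ← ENNReal.ofReal_div_of_pos (by positivity)]
  refine ENNReal.ofReal_le_ofReal ?_
  rw [div_le_iff₀ (by positivity)]
  have h16 := sixteen_le_twenty_mul_q0
  nlinarith [hL3pos, h16, hq₀]

end Summit.AtomisticToContinuum.BoseEinsteinCondensation.Cruxes.TwoReplicaTransienceBound.TracerDecoupling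

end
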